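import Literature.MathematicalPhysics.QuantumFieldTheory.Balaban1983to89.B9RWSums346SecondDiffGpLeft

/-!
# `Balaban1983to89.B9RWSums346SecondDiffGpLeftPairM` — [B9] Thm 3.7's same-side second-order `L²` members of `G′` by the left Neumann series, AT THE LETTERS OF THE
# ALL-BLOCKS AGGREGATOR `B9RWSumsAllBlocksPairMDir.thm37Printed_allPin_completePairM_dir`: the DROP-IN replacements of `blockBd_second_family5∕3_37_dir` with the same
# conclusion shape (`|Q|·K·e^{−(1−2α)δd}`, here `K = 2N₃B₃`) from that theorem's own hypotheses MINUS `FactorsL2Second37Dir` (dag-n06-d CALL on LOCATED-SCHEMA-1)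

T. Bałaban, *Propagators for lattice gauge theories in a background field*, Commun. Math. Phys. **99** (1985) 389–434 [`Balaban1985BackgroundPropagators`, "B9"],
Thm 3.7 (3.87)–(3.90) pp. 408–410, (3.46) p. 398, p. 391; T. Bałaban, *Propagators and renormalization transformations for lattice gauge theories. II*, Commun. Math.
Phys. **96** (1984) 223–250 [`Balaban1984PropagatorsII`], (2.52)–(2.55) pp. 232–233, Lemma 2.1 (2.60)–(2.61) p. 234; [`Balaban1985Variational`] (188) p. 308.

statement-level skeleton of published theorems with citation tags; proofs where landed; nothing here is a claim about the Yang–Mills mass gap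

WHY THIS FILE (cell `pub-ymgap`, node N06 [B9], rows 18; width seat `pub-ymgap-dag-n06-w1` (g5)).  `B9RWSums346SecondDiffGpLeft` runs the left Neumann series at the
rate `δ₁` of a displayed (2.61) instance and feeds `V`'s block bound at the rate `δ₀ − αδ` of the Schur step.  The aggregator's letters are: Cor 3.6 and the legs at ONE
rate `δ₁` (`Local342 … B₁ δ₁`, `L2SecondLegs37 … B₃ δ₁`), ONE (2.61) instance `Ineq261 d₁ … δ₁ α₁`, the member facts `Facts347 … δ α L₀` with
`δ ≤ (1 − 2α₁)δ₁`, `2αδ ≤ δ`, the sizes `κ.Bounded Kc θ₀ Cℓ M` and an «M sufficiently large» threshold.  THIS FILE bridges the two: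
* §1 ★ `l2line5_left_of_rowSum` — the series at any rate `δ_V ≥ σ` against the plain row sum `Σ_{y′}e^{−σd(y,y′)} ≤ c` (so that the EXISTING instance `σ = α₁δ₁` serves the
  rate `δ_V = δ₁ − αδ`); conclusion `2N₃B₃·e^{−(δ_V − σ)d}`;
* §2 ★★★ `blockBd_second_family5_left_pairM` ∕ ★★★ `blockBd_second_family3_left_pairM` — the drop-ins: hypotheses = those of `thm37Printed_allPin_completePairM_dir` available at
  one member and configuration (+ `0 ≤ Cℓ`, the letter transposes `hGsqT hPt hCt`, and the threshold `2N′B₁e^{δ₁ρ}θ₀√L₀·c₁(α₁) ≤ M`), conclusion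
  `|Q|·2N₃B₃·e^{−(1−2α)δd(y,y′)}` between the fibres of `blk` and `blk ∘ fst` — textually what `…_37_dir` delivered with `secondConst … ↦ 2N₃B₃`.
HONEST SCOPE.  Majorant bookkeeping (rates and thresholds) over landed theorems; every analytic input is a displayed hypothesis of the aggregator; nothing of [B9]
asserted; COUNT-NEUTRAL; N06 NOT discharged; K1 NOT closed; one finite lattice programme — nothing continuum, nothing about OS positivity or the mass gap; the YM mass gap
(Clay) is NOT proved by any of this — R4 closes the conditional finite-𝕋⁴ rung `BalabanLadder.UV` only.  NEW file; 0 `def`.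
-/

namespace Literature.MathematicalPhysics.QuantumFieldTheory.Balaban1983to89.B9RWSums346SecondDiffGpLeftPairM

open Literature.MathematicalPhysics.QuantumFieldTheory.Balaban1983to89
open Finset B6RandomWalk B6RandomWalkHom B9Thm37Sum B9Thm34Ext B9Thm37Glue B9Thm37Whole B9Cor38Whole
open B9RWSums343to347Whole B9RWSums346Schur B9Thm37GlueCor36 B9RWSums343Holder B9RWSums343HolderGp B9RWSums346Lap
open B9RWSums344Input B9RWSums344InputGp B9RWSums346Two B9RWSums346TwoGp B11SectG B9Thm37AllNorms B9SectDL2Decay B9RWSums346SecondDiff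
open B9RWSums346SecondDiffGp B9Thm37WholeDir B9Thm37KLetterDir B9RWSums346SecondDiffGpDir B9RWSums346SecondDiffGpLeft

noncomputable section

section GpSide

variable {g : B9.Geometry} [Fintype g.Site] [DecidableEq g.Site] {R : ℝ} {H : Prop} {B : B9.Backgrounds}
variable {X Y ι P : Type} [Fintype P]

omit [Fintype g.Site] [DecidableEq g.Site] [Fintype P] in
/-- Algebra of the transposed (3.88) read through an operator on the right. [folklore] -/
private theorem left_split {Y' : Type} {E : (Y' → ℝ) →ₗ[ℝ] (X → ℝ)} {G G0 V : Module.End ℝ (X → ℝ)} (h : G = G0 + V * G) :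
    G ∘ₗ E = G0 ∘ₗ E + V ∘ₗ (G ∘ₗ E) := by
  conv_lhs => rw [h]
  apply LinearMap.ext
  intro μ
  simp only [LinearMap.comp_apply, LinearMap.add_apply, Module.End.mul_apply]

/-! ## §1 The series at a rate `δ_V ≥ σ` against a plain row sum at the rate `σ` -/

/-- ★ **THE SIXTH `L²` MEMBER OF (3.46) FOR `G′` BY THE LEFT NEUMANN SERIES, ROW-SUM FORM**: legs `h_□G′_□h_□∇\*∇\*` with constant `B₃` at a rate `δ_L ≥ δ_V`, `V`'s block
bound `θ_V·e^{−δ_Vd}`, the row sum `Σ_{y′}e^{−σd(y,y′)} ≤ c` ([4] (2.61) at ANY rate `σ ≤ δ_V`), `θ_V·c ≤ ½`, the transposed (3.88): `BlockBd blk blk (G′ ∘ (∇\*_ν ∘ ∇\*_μ))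
(2N₃B₃·e^{−(δ_V−σ)d})`. [cite: Balaban1985BackgroundPropagators, Thm 3.7 (3.87)–(3.90) pp.408–410 + (3.46) p.398; Balaban1984PropagatorsII, (2.54) p.233 + Lemma 2.1 (2.61) p.234; Balaban1985Variational, (188) p.308] -/
theorem l2line5_left_of_rowSum [Fintype X] [DecidableEq X] [Fintype ι]
    (𝔬 : Ops g B X Y ι) (𝔡 : DirOps37 𝔬 P) (𝔩 : DirLetters37 𝔬 P) (R : ℝ) (H : Prop) (δL δV σ c ρ N N' Cℓ N3 B3 θV : ℝ) (κ : Sizes)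
    (S3 : ι → Finset g.Site) (U : B.Cfg)
    (hN3 : 0 ≤ N3) (hB3 : 0 ≤ B3) (hθV : 0 ≤ θV) (hσ : 0 ≤ σ) (hσV : σ ≤ δV) (hVL : δV ≤ δL)
    (hs : StaticOK 𝔬 ρ N N' Cℓ κ) (hcnt3 : ∀ a : g.Site, (∑ i, if a ∈ S3 i then (1 : ℝ) else 0) ≤ N3)
    (hrow : RowSum (toB6 g R H) σ c) (hi : Identities₂ 𝔬 𝔡 𝔩 R H U)
    (hL : L2SecondLegs37 𝔬 𝔡 R H S3 B3 δL U)
    (hV : BlockBd (g := toB6 g R H) 𝔬.blk 𝔬.blk (VDir 𝔬 𝔡 𝔩 U) (fun (a b : g.Site) => θV * Real.exp (-(δV * g.dist a b))))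
    (hsmall : θV * c ≤ 1 / 2) (ν μ : P) :
    BlockBd (g := toB6 g R H) 𝔬.blk 𝔬.blk (𝔬.Gp U ∘ₗ (𝔡.Dsd U ν ∘ₗ 𝔡.Dsd U μ))
      (fun (a b : g.Site) => 2 * (N3 * B3) * Real.exp (-((δV - σ) * g.dist a b))) := by
  have htri : Triangle254 (toB6 g R H) := fun a b c => hs.tri a b c
  have hdnn : ∀ a b : (toB6 g R H).Site, 0 ≤ (toB6 g R H).dist a b := fun a b => hs.dnn a b
  have hρ0 : 0 ≤ δV - σ := by linarith
  have hfix := left_split (E := 𝔡.Dsd U ν ∘ₗ 𝔡.Dsd U μ) (fixedPointT_dir hi)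
  have hsumE : (∑ i, mulOp (𝔬.h i) * 𝔬.Gsq U i * mulOp (𝔬.h i)) ∘ₗ (𝔡.Dsd U ν ∘ₗ 𝔡.Dsd U μ) =
      ∑ i, (mulOp (𝔬.h i) * 𝔬.Gsq U i * mulOp (𝔬.h i)) ∘ₗ (𝔡.Dsd U ν ∘ₗ 𝔡.Dsd U μ) := by
    apply LinearMap.ext
    intro f
    simp only [LinearMap.comp_apply, LinearMap.sum_apply]
  have hhead := blockBd_localSum (R := R) (H := H) 𝔬.blk 𝔬.blk
    (fun i => (mulOp (𝔬.h i) * 𝔬.Gsq U i * mulOp (𝔬.h i)) ∘ₗ (𝔡.Dsd U ν ∘ₗ 𝔡.Dsd U μ))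
    (fun i (a : g.Site) => if a ∈ S3 i then (1 : ℝ) else 0) (fun (a b : g.Site) => B3 * Real.exp (-(δL * g.dist a b))) N3
    (fun a b => mul_nonneg hB3 (Real.exp_nonneg _)) (fun i => hL.l5 i ν μ) hcnt3
  rw [← hsumE] at hhead
  have hS : BlockBd (g := toB6 g R H) 𝔬.blk 𝔬.blk ((∑ i, mulOp (𝔬.h i) * 𝔬.Gsq U i * mulOp (𝔬.h i)) ∘ₗ (𝔡.Dsd U ν ∘ₗ 𝔡.Dsd U μ))
      (fun (a b : g.Site) => N3 * B3 * Real.exp (-((δV - σ) * (toB6 g R H).dist a b))) := by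
    refine hhead.mono fun a b => ?_
    have hexp : Real.exp (-(δL * g.dist a b)) ≤ Real.exp (-((δV - σ) * g.dist a b)) :=
      Real.exp_le_exp.mpr (neg_le_neg (mul_le_mul_of_nonneg_right (by linarith) (hs.dnn a b)))
    calc N3 * (B3 * Real.exp (-(δL * g.dist a b))) = N3 * B3 * Real.exp (-(δL * g.dist a b)) := by ring
      _ ≤ N3 * B3 * Real.exp (-((δV - σ) * g.dist a b)) := mul_le_mul_of_nonneg_left hexp (mul_nonneg hN3 hB3)
      _ = N3 * B3 * Real.exp (-((δV - σ) * (toB6 g R H).dist a b)) := by simp only [toB6_dist]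
  have hV' : BlockBd (g := toB6 g R H) 𝔬.blk 𝔬.blk (VDir 𝔬 𝔡 𝔩 U) (fun (a b : g.Site) => θV * Real.exp (-(δV * (toB6 g R H).dist a b))) :=
    hV.mono fun a b => by simp only [toB6_dist]; exact le_rfl
  obtain ⟨M₀, hM₀, hap⟩ := exists_blockBd_const (g := g) (R := R) (H := H) 𝔬.blk 𝔬.blk (𝔬.Gp U ∘ₗ (𝔡.Dsd U ν ∘ₗ 𝔡.Dsd U μ))
  rw [blockBd_iff_hasMaj] at hS hV' hap
  have hq : (l2w (toB6 g R H) 𝔬.blk (fun _ => (1 : ℝ)) (fun _ => zero_le_one)).κ * θV * c < 1 := by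
    rw [l2w_κ, one_mul]; linarith
  have hN := neumann_majorant (b₁ := l2w (toB6 g R H) 𝔬.blk (fun _ => (1 : ℝ)) (fun _ => zero_le_one))
    (b₂ := l2w (toB6 g R H) 𝔬.blk (fun _ => (1 : ℝ)) (fun _ => zero_le_one)) htri hdnn hrow hθV (mul_nonneg hN3 hB3) hM₀ hρ0 (by linarith)
    hV' hS hfix hap hq
  rw [blockBd_iff_hasMaj]
  refine hN.mono fun a b => ?_
  rw [l2w_κ, one_mul]
  have hinv : (1 - θV * c)⁻¹ ≤ 2 := by
    rw [inv_le_comm₀ (by linarith) (by norm_num : (0 : ℝ) < 2)]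
    linarith
  have hK0 : 0 ≤ N3 * B3 := mul_nonneg hN3 hB3
  calc N3 * B3 * (1 - θV * c)⁻¹ * Real.exp (-((δV - σ) * (toB6 g R H).dist a b))
      ≤ N3 * B3 * 2 * Real.exp (-((δV - σ) * (toB6 g R H).dist a b)) :=
        mul_le_mul_of_nonneg_right (mul_le_mul_of_nonneg_left hinv hK0) (Real.exp_nonneg _)
    _ = 2 * (N3 * B3) * Real.exp (-((δV - σ) * g.dist a b)) := by simp only [toB6_dist]; ring

/-! ## §2 The drop-ins at the aggregator's letters -/

/-- «M sufficiently large» for the transposed kernel: the sizes `k_P + k_C, k_{Pᵗ} + C_ℓk_{Cᵗ} ≤ θ₀M⁻¹` and the threshold `2N′B₁e^{δ₁ρ}θ₀√L₀·c ≤ M` give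
`N′·√(A_V·A_R·L₀)·c ≤ ½` (`A_V = B₁e^{δ₁ρ}(k_{Pᵗ} + C_ℓk_{Cᵗ})`, `A_R = B₁e^{δ₁ρ}(k_P + k_C)`). [cite: Balaban1985BackgroundPropagators, (3.89) p.409 («O(M⁻¹)»), bookkeeping] -/
theorem small_of_sizes_sqrt {N' B₁ ex sV sR θ₀ L₀ c M : ℝ} (hN' : 0 ≤ N') (hB : 0 ≤ B₁ * ex) (hc : 0 ≤ c) (hM : 0 < M) (hL₀ : 0 ≤ L₀)
    (hsV0 : 0 ≤ sV) (hsR0 : 0 ≤ sR) (hsV : sV ≤ θ₀ * M⁻¹) (hsR : sR ≤ θ₀ * M⁻¹) (hbig : 2 * N' * (B₁ * ex * θ₀) * Real.sqrt L₀ * c ≤ M) :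
    N' * Real.sqrt ((B₁ * ex * sV) * (B₁ * ex * sR) * L₀) * c ≤ 1 / 2 := by
  have hθ : 0 ≤ θ₀ * M⁻¹ := hsV0.trans hsV
  have h1 : (B₁ * ex * sV) * (B₁ * ex * sR) * L₀ ≤ (B₁ * ex * (θ₀ * M⁻¹)) ^ 2 * L₀ := by
    have h2 : (B₁ * ex * sV) * (B₁ * ex * sR) ≤ (B₁ * ex * (θ₀ * M⁻¹)) * (B₁ * ex * (θ₀ * M⁻¹)) :=
      mul_le_mul (mul_le_mul_of_nonneg_left hsV hB) (mul_le_mul_of_nonneg_left hsR hB) (mul_nonneg hB hsR0) (mul_nonneg hB hθ)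
    rw [sq]; exact mul_le_mul_of_nonneg_right h2 hL₀
  have h3 : Real.sqrt ((B₁ * ex * sV) * (B₁ * ex * sR) * L₀) ≤ B₁ * ex * (θ₀ * M⁻¹) * Real.sqrt L₀ := by
    calc Real.sqrt ((B₁ * ex * sV) * (B₁ * ex * sR) * L₀) ≤ Real.sqrt ((B₁ * ex * (θ₀ * M⁻¹)) ^ 2 * L₀) := Real.sqrt_le_sqrt h1
      _ = B₁ * ex * (θ₀ * M⁻¹) * Real.sqrt L₀ := by rw [Real.sqrt_mul (sq_nonneg _), Real.sqrt_sq (mul_nonneg hB hθ)]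
  have h4 : N' * Real.sqrt ((B₁ * ex * sV) * (B₁ * ex * sR) * L₀) * c ≤ N' * (B₁ * ex * (θ₀ * M⁻¹) * Real.sqrt L₀) * c :=
    mul_le_mul_of_nonneg_right (mul_le_mul_of_nonneg_left h3 hN') hc
  have h5 : N' * (B₁ * ex * (θ₀ * M⁻¹) * Real.sqrt L₀) * c = (2 * N' * (B₁ * ex * θ₀) * Real.sqrt L₀ * c) * M⁻¹ / 2 := by ring
  have hMinv : 0 ≤ M⁻¹ := inv_nonneg.mpr hM.le
  have h6 : (2 * N' * (B₁ * ex * θ₀) * Real.sqrt L₀ * c) * M⁻¹ ≤ 1 := by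
    calc (2 * N' * (B₁ * ex * θ₀) * Real.sqrt L₀ * c) * M⁻¹ ≤ M * M⁻¹ := mul_le_mul_of_nonneg_right hbig hMinv
      _ = 1 := mul_inv_cancel₀ hM.ne'
  calc N' * Real.sqrt ((B₁ * ex * sV) * (B₁ * ex * sR) * L₀) * c ≤ (2 * N' * (B₁ * ex * θ₀) * Real.sqrt L₀ * c) * M⁻¹ / 2 := h4.trans h5.le
    _ ≤ 1 / 2 := by linarith

/-- ★★ **THE SIXTH MEMBER PER DIRECTION PAIR AT THE AGGREGATOR'S LETTERS**: `BlockBd blk blk (G′ ∘ (∇\*_ν ∘ ∇\*_μ)) (2N₃B₃·e^{−(1−2α)δd})` from the hypotheses of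
`thm37Printed_allPin_completePairM_dir` at one member and configuration — Cor 3.6 `Local342 … B₁ δ₁`, `DirSupSq37`, `Identities₂`, the legs `L2SecondLegs37 … B₃ δ₁`,
`Ineq261 d₁ … δ₁ α₁` (`0 ≤ α₁`), `Facts347 … δ α L₀` (`0 ≤ αδ`, `2αδ ≤ δ`, `δ ≤ (1 − 2α₁)δ₁`), the sizes `κ.Bounded Kc θ₀ Cℓ M` — PLUS `0 ≤ Cℓ`, the letter transposes
`hGsqT hPt hCt`, and the threshold `2N′B₁e^{δ₁ρ}θ₀√L₀·c₁(α₁) ≤ M`; NO `FactorsL2Second37Dir`, NO sup majorant of `G′`.  Route: `blockBd_VDir_of_local342` (rate `δ₁ − αδ`) + §1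
at `σ = α₁δ₁` + `δ₁ − αδ − α₁δ₁ ≥ (1−2α)δ`. [cite: Balaban1985BackgroundPropagators, Thm 3.7 (3.87)–(3.90) pp.408–410, Cor 3.6 p.408, (3.46) p.398, p.391; Balaban1984PropagatorsII, (2.52)–(2.55) pp.232–233, Lemma 2.1 (2.60)–(2.61) p.234] -/
theorem l2line5_left_pairM [Fintype X] [DecidableEq X] [Fintype Y] [Fintype ι]
    (𝔬 : Ops g B X Y ι) (𝔡 : DirOps37 𝔬 P) (𝔩 : DirLetters37 𝔬 P) (R : ℝ) (H : Prop) (d d₁ : ℕ) (δ α L₀ δ₁ α₁ ρ N N' Cℓ N3 B3 B₁ Kc θ₀ : ℝ) (κ : Sizes)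
    (S3 : ι → Finset g.Site) (U : B.Cfg)
    (hN' : 0 ≤ N') (hN3 : 0 ≤ N3) (hB3 : 0 ≤ B3) (hB₁ : 0 ≤ B₁) (hCℓ : 0 ≤ Cℓ) (hδ₁ : 0 ≤ δ₁) (hα₁ : 0 ≤ α₁)
    (hα : 0 ≤ α * δ) (hα2 : 2 * α * δ ≤ δ) (hδ5 : δ ≤ (1 - 2 * α₁) * δ₁)
    (hs : StaticOK 𝔬 ρ N N' Cℓ κ) (hκ : κ.Bounded Kc θ₀ Cℓ g.M) (hMpos : 0 < g.M)
    (hMbig : 2 * N' * (B₁ * Real.exp (δ₁ * ρ) * θ₀) * Real.sqrt L₀ * B6.c1 d₁ δ₁ α₁ ≤ g.M)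
    (hcnt3 : ∀ a : g.Site, (∑ i, if a ∈ S3 i then (1 : ℝ) else 0) ≤ N3)
    (h261 : Ineq261 d₁ (toB6 g R H) δ₁ α₁) (hF : Facts347 g R H d δ α L₀) (hi : Identities₂ 𝔬 𝔡 𝔩 R H U)
    (hl : Local342 𝔬 R H B₁ δ₁ U) (hT : DirSupSq37 𝔬 𝔡 R H U) (hL : L2SecondLegs37 𝔬 𝔡 R H S3 B3 δ₁ U)
    (hDT : DirTranspose37 𝔬 𝔡 U) (hGsqT : ∀ i, IsTransposePair (𝔬.Gsq U i) (𝔬.Gsq U i)) (hPt : ∀ i μ, IsTransposePair (𝔩.Pt U i μ) (𝔩.P U i μ))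
    (hCt : ∀ i, IsTransposePair (𝔬.Ct U i) (𝔬.Cop U i)) (ν μ : P) :
    BlockBd (g := toB6 g R H) 𝔬.blk 𝔬.blk (𝔬.Gp U ∘ₗ (𝔡.Dsd U ν ∘ₗ 𝔡.Dsd U μ))
      (fun (a b : g.Site) => 2 * (N3 * B3) * Real.exp (-((1 - 2 * α) * δ * g.dist a b))) := by
  have hL₀ : 0 ≤ L₀ := le_trans (le_trans zero_le_one hF.one_le_L) hF.L_le
  have hc1 : 0 ≤ B6.c1 d₁ δ₁ α₁ := c1_nonneg d₁ δ₁ α₁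
  have hBe : 0 ≤ B₁ * Real.exp (δ₁ * ρ) := mul_nonneg hB₁ (Real.exp_nonneg _)
  have hsV0 : 0 ≤ κ.kPt + Cℓ * κ.kCt := add_nonneg hκ.nonneg.kPt (mul_nonneg hCℓ hκ.nonneg.kCt)
  have hsR0 : 0 ≤ κ.kP + κ.kC := add_nonneg hκ.nonneg.kP hκ.nonneg.kC
  -- `V`'s block bound at the rate `δ₁ − αδ` and its smallness
  have hV0 := blockBd_VDir_of_local342 (R := R) (H := H) 𝔬 𝔡 𝔩 U hF hα hB₁ hδ₁ hCℓ hN' hκ.nonneg hs hl hT hi hDT hGsqT hPt hCt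
  have hsmall : N' * Real.sqrt ((B₁ * Real.exp (δ₁ * ρ) * (κ.kPt + Cℓ * κ.kCt)) * (B₁ * Real.exp (δ₁ * ρ) * (κ.kP + κ.kC)) * L₀) * B6.c1 d₁ δ₁ α₁ ≤ 1 / 2 :=
    small_of_sizes_sqrt hN' hBe hc1 hMpos hL₀ hsV0 hsR0 hκ.col hκ.row hMbig
  have hθV : 0 ≤ N' * Real.sqrt ((B₁ * Real.exp (δ₁ * ρ) * (κ.kPt + Cℓ * κ.kCt)) * (B₁ * Real.exp (δ₁ * ρ) * (κ.kP + κ.kC)) * L₀) :=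
    mul_nonneg hN' (Real.sqrt_nonneg _)
  -- the row sum at `σ = α₁δ₁` serves the rate `δ_V = δ₁ − αδ`
  have hrow : RowSum (toB6 g R H) (α₁ * δ₁) (B6.c1 d₁ δ₁ α₁) := (rowSum_iff_ineq261 d₁ (toB6 g R H) δ₁ α₁).mp h261
  have hσV : α₁ * δ₁ ≤ δ₁ - α * δ := by nlinarith
  have hK : 0 ≤ 2 * (N3 * B3) := by positivity
  have h := l2line5_left_of_rowSum 𝔬 𝔡 𝔩 R H δ₁ (δ₁ - α * δ) (α₁ * δ₁) (B6.c1 d₁ δ₁ α₁) ρ N N' Cℓ N3 B3 _ κ S3 U hN3 hB3 hθV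
    (mul_nonneg hα₁ hδ₁) hσV (by linarith) hs hcnt3 hrow hi hL hV0 hsmall ν μ
  refine h.mono fun a b => mul_le_mul_of_nonneg_left ?_ hK
  exact Real.exp_le_exp.mpr (neg_le_neg (mul_le_mul_of_nonneg_right (by nlinarith) (hs.dnn a b)))

/-- ★★ **THE FOURTH MEMBER PER DIRECTION PAIR AT THE AGGREGATOR'S LETTERS** (adjoint transfer; `G′` symmetric): `BlockBd blk blk ((∇_ν ∘ ∇_μ) ∘ G′) (2N₃B₃·e^{−(1−2α)δd})`.
[cite: Balaban1985BackgroundPropagators, (3.46) p.398 (fourth member) + p.391 + Thm 3.7 pp.408–410] -/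
theorem l2line3_left_pairM [Fintype X] [DecidableEq X] [Fintype Y] [Fintype ι]
    (𝔬 : Ops g B X Y ι) (𝔡 : DirOps37 𝔬 P) (𝔩 : DirLetters37 𝔬 P) (R : ℝ) (H : Prop) (d d₁ : ℕ) (δ α L₀ δ₁ α₁ ρ N N' Cℓ N3 B3 B₁ Kc θ₀ : ℝ) (κ : Sizes)
    (S3 : ι → Finset g.Site) (U : B.Cfg)
    (hN' : 0 ≤ N') (hN3 : 0 ≤ N3) (hB3 : 0 ≤ B3) (hB₁ : 0 ≤ B₁) (hCℓ : 0 ≤ Cℓ) (hδ₁ : 0 ≤ δ₁) (hα₁ : 0 ≤ α₁)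
    (hα : 0 ≤ α * δ) (hα2 : 2 * α * δ ≤ δ) (hδ5 : δ ≤ (1 - 2 * α₁) * δ₁)
    (hs : StaticOK 𝔬 ρ N N' Cℓ κ) (hκ : κ.Bounded Kc θ₀ Cℓ g.M) (hMpos : 0 < g.M)
    (hMbig : 2 * N' * (B₁ * Real.exp (δ₁ * ρ) * θ₀) * Real.sqrt L₀ * B6.c1 d₁ δ₁ α₁ ≤ g.M)
    (hcnt3 : ∀ a : g.Site, (∑ i, if a ∈ S3 i then (1 : ℝ) else 0) ≤ N3)
    (h261 : Ineq261 d₁ (toB6 g R H) δ₁ α₁) (hF : Facts347 g R H d δ α L₀) (hi : Identities₂ 𝔬 𝔡 𝔩 R H U)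
    (hl : Local342 𝔬 R H B₁ δ₁ U) (hT : DirSupSq37 𝔬 𝔡 R H U) (hL : L2SecondLegs37 𝔬 𝔡 R H S3 B3 δ₁ U)
    (hDT : DirTranspose37 𝔬 𝔡 U) (hGsqT : ∀ i, IsTransposePair (𝔬.Gsq U i) (𝔬.Gsq U i)) (hPt : ∀ i μ, IsTransposePair (𝔩.Pt U i μ) (𝔩.P U i μ))
    (hCt : ∀ i, IsTransposePair (𝔬.Ct U i) (𝔬.Cop U i)) (hsym : IsTransposePair (𝔬.Gp U) (𝔬.Gp U)) (ν μ : P) :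
    BlockBd (g := toB6 g R H) 𝔬.blk 𝔬.blk ((𝔡.Dd U ν ∘ₗ 𝔡.Dd U μ) ∘ₗ 𝔬.Gp U)
      (fun (a b : g.Site) => 2 * (N3 * B3) * Real.exp (-((1 - 2 * α) * δ * g.dist a b))) := by
  have h5 := l2line5_left_pairM 𝔬 𝔡 𝔩 R H d d₁ δ α L₀ δ₁ α₁ ρ N N' Cℓ N3 B3 B₁ Kc θ₀ κ S3 U hN' hN3 hB3 hB₁ hCℓ hδ₁ hα₁ hα hα2 hδ5 hs hκ hMpos hMbig
    hcnt3 h261 hF hi hl hT hL hDT hGsqT hPt hCt μ ν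
  have hK : 0 ≤ 2 * (N3 * B3) := by positivity
  have hadj : IsTransposePair (𝔬.Gp U ∘ₗ (𝔡.Dsd U μ ∘ₗ 𝔡.Dsd U ν)) ((𝔡.Dd U ν ∘ₗ 𝔡.Dd U μ) ∘ₗ 𝔬.Gp U) :=
    ((hDT.tr ν).comp (hDT.tr μ)).comp hsym
  have h := blockBd_of_adjoint (g := toB6 g R H) (blk₁ := 𝔬.blk) (blk₂ := 𝔬.blk) (T := (𝔡.Dd U ν ∘ₗ 𝔡.Dd U μ) ∘ₗ 𝔬.Gp U)
    (T' := 𝔬.Gp U ∘ₗ (𝔡.Dsd U μ ∘ₗ 𝔡.Dsd U ν)) (fun u w => by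
      rw [dotProduct, dotProduct]
      exact (hadj u w).symm) h5 (fun y y' => mul_nonneg hK (Real.exp_nonneg _))
  refine h.mono fun y y' => ?_
  rw [hs.symm y' y]

/-- ★★★ **THE DROP-IN FOR `blockBd_second_family5_37_dir`**: the packaged family `G′∇\*_{U,ν}∇\*_{U,μ}` over `Q × Q`, `|Q|·2N₃B₃·e^{−(1−2α)δd}` between the fibres of `blk` and
`blk ∘ fst` — textually `…_37_dir`'s conclusion with `secondConst … ↦ 2N₃B₃`, from its hypotheses WITHOUT `FactorsL2Second37Dir` ∕ `h0` (see `l2line5_left_pairM`).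
[cite: Balaban1985BackgroundPropagators, (3.46) p.398 + (3.39) p.397 + Thm 3.7 pp.408–410] -/
theorem blockBd_second_family5_left_pairM [Fintype X] [DecidableEq X] [Fintype Y] [Fintype ι]
    (𝔬 : Ops g B X Y ι) (𝔡 : DirOps37 𝔬 P) (𝔩 : DirLetters37 𝔬 P) (R : ℝ) (H : Prop) (d d₁ : ℕ) (δ α L₀ δ₁ α₁ ρ N N' Cℓ N3 B3 B₁ Kc θ₀ : ℝ) (κ : Sizes)
    (S3 : ι → Finset g.Site) (U : B.Cfg)
    (hN' : 0 ≤ N') (hN3 : 0 ≤ N3) (hB3 : 0 ≤ B3) (hB₁ : 0 ≤ B₁) (hCℓ : 0 ≤ Cℓ) (hδ₁ : 0 ≤ δ₁) (hα₁ : 0 ≤ α₁)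
    (hα : 0 ≤ α * δ) (hα2 : 2 * α * δ ≤ δ) (hδ5 : δ ≤ (1 - 2 * α₁) * δ₁)
    (hs : StaticOK 𝔬 ρ N N' Cℓ κ) (hκ : κ.Bounded Kc θ₀ Cℓ g.M) (hMpos : 0 < g.M)
    (hMbig : 2 * N' * (B₁ * Real.exp (δ₁ * ρ) * θ₀) * Real.sqrt L₀ * B6.c1 d₁ δ₁ α₁ ≤ g.M)
    (hcnt3 : ∀ a : g.Site, (∑ i, if a ∈ S3 i then (1 : ℝ) else 0) ≤ N3)
    (h261 : Ineq261 d₁ (toB6 g R H) δ₁ α₁) (hF : Facts347 g R H d δ α L₀) (hi : Identities₂ 𝔬 𝔡 𝔩 R H U)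
    (hl : Local342 𝔬 R H B₁ δ₁ U) (hT : DirSupSq37 𝔬 𝔡 R H U) (hL : L2SecondLegs37 𝔬 𝔡 R H S3 B3 δ₁ U)
    (hDT : DirTranspose37 𝔬 𝔡 U) (hGsqT : ∀ i, IsTransposePair (𝔬.Gsq U i) (𝔬.Gsq U i)) (hPt : ∀ i μ, IsTransposePair (𝔩.Pt U i μ) (𝔩.P U i μ))
    (hCt : ∀ i, IsTransposePair (𝔬.Ct U i) (𝔬.Cop U i)) :
    BlockBd (g := toB6 g R H) 𝔬.blk (𝔬.blk ∘ Prod.fst)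
      (familyOp fun p : P × P => 𝔬.Gp U ∘ₗ (𝔡.Dsd U p.1 ∘ₗ 𝔡.Dsd U p.2))
      (fun (a b : g.Site) => (Fintype.card P : ℝ) * (2 * (N3 * B3)) * Real.exp (-((1 - 2 * α) * δ * g.dist a b))) := by
  have hK : 0 ≤ 2 * (N3 * B3) := by positivity
  have h := blockBd_familyOp (R := R) (H := H) 𝔬.blk 𝔬.blk (P := P × P)
    (T := fun p : P × P => 𝔬.Gp U ∘ₗ (𝔡.Dsd U p.1 ∘ₗ 𝔡.Dsd U p.2)) (fun a b => mul_nonneg hK (Real.exp_nonneg _))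
    (fun p => l2line5_left_pairM 𝔬 𝔡 𝔩 R H d d₁ δ α L₀ δ₁ α₁ ρ N N' Cℓ N3 B3 B₁ Kc θ₀ κ S3 U hN' hN3 hB3 hB₁ hCℓ hδ₁ hα₁ hα hα2 hδ5 hs hκ hMpos
      hMbig hcnt3 h261 hF hi hl hT hL hDT hGsqT hPt hCt p.1 p.2)
  refine h.mono fun a b => le_of_eq ?_
  rw [Fintype.card_prod, Nat.cast_mul, Real.sqrt_mul_self (Nat.cast_nonneg _)]
  ring

/-- ★★★ **THE DROP-IN FOR `blockBd_second_family3_37_dir`** (`∇_ν∇_μG′` over `Q × Q`; `G′` symmetric): same hypotheses + `hsym`, same shape.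
[cite: Balaban1985BackgroundPropagators, (3.46) p.398 (fourth member) + (3.39) p.397 + p.391 + Thm 3.7 pp.408–410] -/
theorem blockBd_second_family3_left_pairM [Fintype X] [DecidableEq X] [Fintype Y] [Fintype ι]
    (𝔬 : Ops g B X Y ι) (𝔡 : DirOps37 𝔬 P) (𝔩 : DirLetters37 𝔬 P) (R : ℝ) (H : Prop) (d d₁ : ℕ) (δ α L₀ δ₁ α₁ ρ N N' Cℓ N3 B3 B₁ Kc θ₀ : ℝ) (κ : Sizes)
    (S3 : ι → Finset g.Site) (U : B.Cfg)
    (hN' : 0 ≤ N') (hN3 : 0 ≤ N3) (hB3 : 0 ≤ B3) (hB₁ : 0 ≤ B₁) (hCℓ : 0 ≤ Cℓ) (hδ₁ : 0 ≤ δ₁) (hα₁ : 0 ≤ α₁)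
    (hα : 0 ≤ α * δ) (hα2 : 2 * α * δ ≤ δ) (hδ5 : δ ≤ (1 - 2 * α₁) * δ₁)
    (hs : StaticOK 𝔬 ρ N N' Cℓ κ) (hκ : κ.Bounded Kc θ₀ Cℓ g.M) (hMpos : 0 < g.M)
    (hMbig : 2 * N' * (B₁ * Real.exp (δ₁ * ρ) * θ₀) * Real.sqrt L₀ * B6.c1 d₁ δ₁ α₁ ≤ g.M)
    (hcnt3 : ∀ a : g.Site, (∑ i, if a ∈ S3 i then (1 : ℝ) else 0) ≤ N3)
    (h261 : Ineq261 d₁ (toB6 g R H) δ₁ α₁) (hF : Facts347 g R H d δ α L₀) (hi : Identities₂ 𝔬 𝔡 𝔩 R H U)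
    (hl : Local342 𝔬 R H B₁ δ₁ U) (hT : DirSupSq37 𝔬 𝔡 R H U) (hL : L2SecondLegs37 𝔬 𝔡 R H S3 B3 δ₁ U)
    (hDT : DirTranspose37 𝔬 𝔡 U) (hGsqT : ∀ i, IsTransposePair (𝔬.Gsq U i) (𝔬.Gsq U i)) (hPt : ∀ i μ, IsTransposePair (𝔩.Pt U i μ) (𝔩.P U i μ))
    (hCt : ∀ i, IsTransposePair (𝔬.Ct U i) (𝔬.Cop U i)) (hsym : IsTransposePair (𝔬.Gp U) (𝔬.Gp U)) :
    BlockBd (g := toB6 g R H) 𝔬.blk (𝔬.blk ∘ Prod.fst)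
      (familyOp fun p : P × P => (𝔡.Dd U p.1 ∘ₗ 𝔡.Dd U p.2) ∘ₗ 𝔬.Gp U)
      (fun (a b : g.Site) => (Fintype.card P : ℝ) * (2 * (N3 * B3)) * Real.exp (-((1 - 2 * α) * δ * g.dist a b))) := by
  have hK : 0 ≤ 2 * (N3 * B3) := by positivity
  have h := blockBd_familyOp (R := R) (H := H) 𝔬.blk 𝔬.blk (P := P × P)
    (T := fun p : P × P => (𝔡.Dd U p.1 ∘ₗ 𝔡.Dd U p.2) ∘ₗ 𝔬.Gp U) (fun a b => mul_nonneg hK (Real.exp_nonneg _))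
    (fun p => l2line3_left_pairM 𝔬 𝔡 𝔩 R H d d₁ δ α L₀ δ₁ α₁ ρ N N' Cℓ N3 B3 B₁ Kc θ₀ κ S3 U hN' hN3 hB3 hB₁ hCℓ hδ₁ hα₁ hα hα2 hδ5 hs hκ hMpos
      hMbig hcnt3 h261 hF hi hl hT hL hDT hGsqT hPt hCt hsym p.1 p.2)
  refine h.mono fun a b => le_of_eq ?_
  rw [Fintype.card_prod, Nat.cast_mul, Real.sqrt_mul_self (Nat.cast_nonneg _)]
  ring

end GpSide

end

end Literature.MathematicalPhysics.QuantumFieldTheory.Balaban1983to89.B9RWSums346SecondDiffGpLeftPairM
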